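import Mathlib
import HarnessLib
import Summits.ResolutionOfSingularities.ResolutionOfSingularities.Theorems.WildQuotientsWildQuotientResolutionS1aKillFreeKN
import Summits.ResolutionOfSingularities.ResolutionOfSingularities.Theorems.WildQuotientsWildQuotientResolutionS1aKillFreeFTools
import Summits.ResolutionOfSingularities.ResolutionOfSingularities.Theorems.WildQuotientsWildQuotientResolutionS1aKillCentreRule

/-!
# S1a — K-FREE FRAME, the ROOT-KILL INSTANCE SCHEME: a one-shot kill whose designated charts cover `F_𝔄` discharges `ReachLowerInF` for that datum

[OURS · L1 W4.5c · lead-1 g12; plan-1 RULING R-F15 (3) / R-F15a (a) «I-1 = root kill: at the root atlas `killAtlas` applies verbatim; `U = ⋃ O_c ⊇ F`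
⇒ `F′ = ∅` ⇒ leaf by (F-T0); `P := {root pair} ∪ {(M′, killAtlas …)}`, the latter Terminal ((F-T10)), obligations vacuous», A-KF v1 §1.4/§3.4] — NOT
statements of the manuscript; counted 0; AI-level work, weaker than expert review. Crux stmt-ResolutionOfSingularities-17941 `CyclicQuotientFourfolds`,
line `s1a-logminvertex` v12 (`stub_reachLowerInF`). Germ-independent; the first germ (`J₄`) is `…S1aReachLowerInFJordan`.

* `exists_atlas_fLocus_eq_empty_of_cover` — a principal centre with DESIGNATED principal-centre charts `O_c` covering the support AND the carried formal
  locus `F_𝔄`: every realisation carries atlas data with EMPTY formal locus (`exists_killAtlas`: `F_𝔄′ = π′⁻¹(F_𝔄 ∖ ⋃ O_c) = ∅`);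
* ★ `exists_reachLowerF_of_oneShotKill` — THE ONE-SHOT CLASS: if every model of the datum has a Noetherian base ((F-T10) `hasNoetherianBase_of_datum`) and
  the decorated model `(M₀, 𝔄₀)` admits an admissible centre all of whose realisations carry an atlas with empty formal locus, then the conclusion of
  `ReachLowerInF` holds at `(M₀, 𝔄₀)`: `P := {F_𝔄 = ∅} ∪ {one-shot killable}`, trees of depth 1, leaves by (F-T0) `treeF_one_of_move_fLocus_eq_empty`,
  `F_𝔄 ≠ ∅ ⇐ ¬Terminal` by `terminal_of_fLocus_eq_empty`;
* ★★ `exists_reachLowerF_of_coveringKill` — the two combined: a NAMED principal centre at `(M₀, 𝔄₀)` whose designated kill charts cover `supp ∪ F_𝔄₀`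
  discharges the stub's conclusion for that datum and ANY such root decoration.
-/

set_option linter.dupNamespace false

noncomputable section

open CategoryTheory Limits AlgebraicGeometry TopologicalSpace Topology
open Literature.AlgebraicGeometry.Resolution Literature.AlgebraicGeometry.RelativeSpec
open Summit.ResolutionOfSingularities.ResolutionOfSingularities.Theorems.WildQuotientResolution.S1
open Summit.ResolutionOfSingularities.ResolutionOfSingularities.Theorems.WildQuotientResolution.S1.NodeAtlas
open Summit.ResolutionOfSingularities.ResolutionOfSingularities.Theorems.WildQuotientResolution.S1.NpFrame

namespace Summit.ResolutionOfSingularities.ResolutionOfSingularities.Theorems.WildQuotientResolution.S1.GameFrame.GModel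

variable {p : ℕ} {X' X₁ : Scheme.{0}} {q : X' ⟶ X₁} {G : Type} [Group G] {ρ : G →* Aut X'} {g₀ : G}

/-- **Designated kill charts covering the formal locus empty it.** For a principal centre `(𝒦, d)` at the decorated model `(M, 𝔄)` with a designated
family of principal-centre charts `O_c` covering the support of `𝒦_d` AND the carried formal locus `F_𝔄`, every realisation `M′` carries atlas data
with `F_𝔄′ = ∅` (the re-decoration of `exists_killAtlas` has `F_𝔄′ = π′⁻¹(F_𝔄 ∖ ⋃ O_c)`). [OURS · L1 W4.5c · R-F15 (3)] -/
theorem exists_atlas_fLocus_eq_empty_of_cover [Finite G] (hp : p.Prime) (hG : ∀ g : G, g ∈ Subgroup.zpowers g₀)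
    (M M' : GModel p q G ρ g₀) (hB : M.HasNoetherianBase) (𝔄 : NodeAtlasData p M.act g₀)
    (𝒦 : ReesFiltration M.V) (d : ℕ) (hprin : IsPrincipalCentre p M.act g₀ 𝒦 d)
    {κ : Type} (Oc : κ → M.act.StableAffineOpens) (hOc : ∀ c, IsPrincipalCentreChart p M.act g₀ 𝒦 d (Oc c))
    (hcov : ((𝒦.ideal d).support : Set M.V) ⊆ ⋃ c, ((Oc c).1 : Set M.V))
    (hF : 𝔄.fLocus ⊆ ⋃ c, ((Oc c).1 : Set M.V)) (hm : M.IsMoveOf M' 𝒦 d) :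
    ∃ 𝔄' : NodeAtlasData p M'.act g₀, 𝔄'.fLocus = ∅ := by
  obtain ⟨R₀, _, _, s, _, hs⟩ := hB
  obtain ⟨π', hbl, -, hr, hcomm⟩ := hm
  obtain ⟨𝔄', h𝔄'⟩ := exists_killAtlas hp hG M M' 𝔄 𝒦 d hprin Oc hOc hcov π' hbl hr hcomm s hs
  refine ⟨𝔄', Set.eq_empty_iff_forall_notMem.mpr fun v' hv' => ?_⟩
  obtain ⟨hU, hFv⟩ := (h𝔄' v').mp hv'
  exact hU (hF hFv)

/-- ★ **THE ONE-SHOT CLASS discharges the stub's conclusion.** If every model of the datum has a Noetherian base and the decorated model `(M₀, 𝔄₀)`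
admits an admissible centre ALL of whose realisations carry atlas data with EMPTY carried formal locus, then there is a class `P ∋ (M₀, 𝔄₀)` of decorated
models from every non-terminal member of which a depth-`1` tree inside `P` reaches `μ_F`-lower decorated models. `P := {F_𝔄 = ∅} ∪ {one-shot killable}`;
members with `F_𝔄 = ∅` are terminal (`terminal_of_fLocus_eq_empty`), so their obligation is vacuous; the others use (F-T0). [OURS · L1 W4.5c · R-F15 (3)] -/
theorem exists_reachLowerF_of_oneShotKill [Finite G] (hp : p.Prime) (hG : ∀ g : G, g ∈ Subgroup.zpowers g₀)
    (hNB : ∀ M : GModel p q G ρ g₀, M.HasNoetherianBase) (M₀ : GModel p q G ρ g₀) (𝔄₀ : NodeAtlasData p M₀.act g₀)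
    (𝒦 : ReesFiltration M₀.V) (d : ℕ) (hadm : IsAdmissibleCentre p M₀.act g₀ 𝒦 d)
    (hkill : ∀ M' : GModel p q G ρ g₀, M₀.IsMoveOf M' 𝒦 d → ∃ 𝔄' : NodeAtlasData p M'.act g₀, 𝔄'.fLocus = ∅) :
    ∃ P : ∀ M : GModel p q G ρ g₀, NodeAtlasData p M.act g₀ → Prop,
      P M₀ 𝔄₀ ∧ ∀ (M : GModel p q G ρ g₀) (𝔄 : NodeAtlasData p M.act g₀), P M 𝔄 → ¬ M.Terminal →
        ∃ n : ℕ, TreeF P (fun N 𝔅 => LexLTF N 𝔅 M 𝔄) n M 𝔄 := by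
  refine ⟨fun M 𝔄 => 𝔄.fLocus = ∅ ∨ ∃ (𝒦₁ : ReesFiltration M.V) (d₁ : ℕ), IsAdmissibleCentre p M.act g₀ 𝒦₁ d₁ ∧
      ∀ M' : GModel p q G ρ g₀, M.IsMoveOf M' 𝒦₁ d₁ → ∃ 𝔄' : NodeAtlasData p M'.act g₀, 𝔄'.fLocus = ∅,
    Or.inr ⟨𝒦, d, hadm, hkill⟩, ?_⟩
  rintro M 𝔄 hP hT
  have hne : 𝔄.fLocus.Nonempty := by
    rw [Set.nonempty_iff_ne_empty]
    exact fun h => hT (GModelBridge.terminal_of_fLocus_eq_empty hG hp M (hNB M) 𝔄 h)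
  rcases hP with h | ⟨𝒦₁, d₁, hadm₁, hkill₁⟩
  · exact absurd h hne.ne_empty
  · refine ⟨1, treeF_one_of_move_fLocus_eq_empty M 𝔄 hne 𝒦₁ d₁ hadm₁ fun M' hm => ?_⟩
    obtain ⟨𝔄', h𝔄'⟩ := hkill₁ M' hm
    exact ⟨𝔄', Or.inl h𝔄', h𝔄'⟩

/-- ★★ **A COVERING ROOT KILL discharges the stub's conclusion.** At a decorated model `(M₀, 𝔄₀)` of a datum all of whose models have a Noetherian base:
a NAMED principal centre `(𝒦, d)` with designated principal-centre charts covering `supp 𝒦_d` and `F_𝔄₀` yields a class `P ∋ (M₀, 𝔄₀)` with bounded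
trees reaching `μ_F`-lower decorated models from every non-terminal member — the conclusion of `ReachLowerInF` at `(M₀, 𝔄₀)`.
[OURS · L1 W4.5c · R-F15 (3) / R-F15a (a): the I-1 scheme] -/
theorem exists_reachLowerF_of_coveringKill [Finite G] (hp : p.Prime) (hG : ∀ g : G, g ∈ Subgroup.zpowers g₀)
    (hNB : ∀ M : GModel p q G ρ g₀, M.HasNoetherianBase) (M₀ : GModel p q G ρ g₀) (𝔄₀ : NodeAtlasData p M₀.act g₀)
    (𝒦 : ReesFiltration M₀.V) (d : ℕ) (hprin : IsPrincipalCentre p M₀.act g₀ 𝒦 d)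
    {κ : Type} (Oc : κ → M₀.act.StableAffineOpens) (hOc : ∀ c, IsPrincipalCentreChart p M₀.act g₀ 𝒦 d (Oc c))
    (hcov : ((𝒦.ideal d).support : Set M₀.V) ⊆ ⋃ c, ((Oc c).1 : Set M₀.V))
    (hF : 𝔄₀.fLocus ⊆ ⋃ c, ((Oc c).1 : Set M₀.V)) :
    ∃ P : ∀ M : GModel p q G ρ g₀, NodeAtlasData p M.act g₀ → Prop,
      P M₀ 𝔄₀ ∧ ∀ (M : GModel p q G ρ g₀) (𝔄 : NodeAtlasData p M.act g₀), P M 𝔄 → ¬ M.Terminal →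
        ∃ n : ℕ, TreeF P (fun N 𝔅 => LexLTF N 𝔅 M 𝔄) n M 𝔄 :=
  exists_reachLowerF_of_oneShotKill hp hG hNB M₀ 𝔄₀ 𝒦 d (isAdmissibleCentre_of_isPrincipalCentre hprin) fun M' hm =>
    exists_atlas_fLocus_eq_empty_of_cover hp hG M₀ M' (hNB M₀) 𝔄₀ 𝒦 d hprin Oc hOc hcov hF hm

/-- **The datum form**: over a field `k` with `f : X₁ → Spec k` locally of finite type and `q` finite, every model has a Noetherian base
(`hasNoetherianBase_of_datum`), so a covering root kill at `(M₀, 𝔄₀)` alone discharges the conclusion of `ReachLowerInF` there. [OURS · L1 W4.5c · R-F15 (3)] -/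
theorem exists_reachLowerF_of_coveringKill_datum [Finite G] (hp : p.Prime) (hG : ∀ g : G, g ∈ Subgroup.zpowers g₀)
    {k : Type} [Field k] (f : X₁ ⟶ Spec (.of k)) [LocallyOfFiniteType f] [IsFinite q]
    (M₀ : GModel p q G ρ g₀) (𝔄₀ : NodeAtlasData p M₀.act g₀)
    (𝒦 : ReesFiltration M₀.V) (d : ℕ) (hprin : IsPrincipalCentre p M₀.act g₀ 𝒦 d)
    {κ : Type} (Oc : κ → M₀.act.StableAffineOpens) (hOc : ∀ c, IsPrincipalCentreChart p M₀.act g₀ 𝒦 d (Oc c))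
    (hcov : ((𝒦.ideal d).support : Set M₀.V) ⊆ ⋃ c, ((Oc c).1 : Set M₀.V))
    (hF : 𝔄₀.fLocus ⊆ ⋃ c, ((Oc c).1 : Set M₀.V)) :
    ∃ P : ∀ M : GModel p q G ρ g₀, NodeAtlasData p M.act g₀ → Prop,
      P M₀ 𝔄₀ ∧ ∀ (M : GModel p q G ρ g₀) (𝔄 : NodeAtlasData p M.act g₀), P M 𝔄 → ¬ M.Terminal →
        ∃ n : ℕ, TreeF P (fun N 𝔅 => LexLTF N 𝔅 M 𝔄) n M 𝔄 :=
  exists_reachLowerF_of_coveringKill hp hG (hasNoetherianBase_of_datum f) M₀ 𝔄₀ 𝒦 d hprin Oc hOc hcov hF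

end Summit.ResolutionOfSingularities.ResolutionOfSingularities.Theorems.WildQuotientResolution.S1.GameFrame.GModel

end
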